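import Summits.Ventures.CertifiedManyBodySolver.Downfold.EmeryAxialSlabHg1201SubsA
import Summits.Ventures.CertifiedManyBodySolver.Downfold.EmeryAxialSlabHg1201SubsB
import Summits.Ventures.CertifiedManyBodySolver.Downfold.EmeryAxialSlabHg1201SubsC
import Summits.Ventures.CertifiedManyBodySolver.Downfold.EmeryFermiFillingLa214
import HarnessLib

/-!
# HgBa₂CuO₄ (box #19 Hg-1201 §OF-RECORD v1.14, P = 0): HOW MUCH AXIAL (Cu-4s / apical) ADMIXTURE DOES THE BOX'S ONE-BAND FERMI SURFACE REQUIRE? — the certified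
# co-shift census of the typed 3BE one-body box `emeryBoxHg1201v114` against its object-E row `t′/t ∈ [-0.57, -0.46]`

Venture CertifiedManyBodySolver, cell `pub/hubbard-downfold` (stage S1, HUMAN RULINGS D-0096/D-0098: the 3 → 1 reduction error is carried explicitly),
seat hubbard-downfold-mod-4 (technique B = band level); namespace `Summit.Ventures.CertifiedManyBodySolver.Downfold.Emery`. Everything PROVED; numerics
decided by the kernel in `EmeryAxialSlabHg1201SubsA`, `EmeryAxialSlabHg1201SubsB`, `EmeryAxialSlabHg1201SubsC`.

CONTEXT. `EmeryFermiFillingHg1201…` certified the σ three-band (d–p_x–p_y + t_pp, t_pp′) Fermi-surface `t′/t` window of this box at its own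
hole count and compared it with the box's object-E row (router/BOXES/HgBa2CuO4.md object-E row «tp/t (E) [−0.57, −0.46]»). `EmeryAxialFermiSurfaceShape` +
`EmeryAxialConductionBand` (TRANSFER THEOREM `condBand_le_iff`, no separation hypothesis) prove that the four-orbital model of [AndersenEtAl1995] /
[PavariniEtAl2001] — Cu-4s (and through it the apical orbitals) added to the σ model — has, AT ITS FERMI LEVEL, exactly the conduction-band occupied
set, filling and Fermi surface of the σ model with CO-SHIFTED O–O hoppings `(t_pp + a, t_pp′ + a)`, ONE scalar `a = a_F = t_sp²/(ε_s − ε_F) ≥ 0`.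
So «how much axial channel does the one-band FS of record require beyond the box's σ rows?» is a one-parameter question, answered here slab by slab
(sub-box rule version B, `EmeryFermiFillingSubBoxB`; edges 0, 0.1, 0.2, 0.25, 0.3 eV; Δ_pd × t_pd split 4 × 2):

| slab | a (eV) | ε_F window (eV above ε_d) | certified t′/t window | vs E row [-0.57, -0.46] |
|---|---|---|---|---|
| 0 | [0, 0.1] | [1.0, 2.38] | [-0.4138, -0.2482] | SHORT |
| 1 | [0.1, 0.2] | [0.96, 2.32] | [-0.4476, -0.2917] | SHORT |
| 2 | [0.2, 0.25] | [0.96, 2.24] | [-0.4593, -0.3234] | SHORT |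
| 3 | [0.25, 0.3] | [0.96, 2.22] | [-0.4714, -0.3372] | MEETS |

READING (certified, numbers not adjectives): `a ∈ [0, 0.25]` ⇒ the co-shifted Fermi surface is STILL LESS cuprate-like than the E row (`t′/t > -0.46`): the REQUIRED axial admixture at the Fermi level is `a_F > 0.25` eV (`emeryBoxHg1201v114_axial_short`). The four-orbital form of the exclusion(s) is `emeryBoxHg1201v114_fourOrbital_short`:
for ANY axial level `ε_s` and coupling `t_sp`, a four-orbital completion of a box point whose conduction band holds the box's electrons at a Fermi level `ε_F < ε_s`
with `t_sp²/(ε_s − ε_F)` in the excluded range does NOT reproduce the E row. (Pavarini's range parameter for the PURE four-orbital model is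
`r = ½/(1 + s)`, `s = (ε_s − ε_F)(ε_F − ε_p)/(2t_sp)² = (ε_F + Δ_pd)/(4·a_total)`, where `a_total` would be the WHOLE O–O co-shift; the box's `t_pp, t_pp′` rows
already contain part of the axial channel when they come from a three-band Wannier fit, so `a_F` here is the ADDITIONAL admixture — a model-form
distance, not a material constant.)

WHAT THIS IS NOT: not a statement that the material's parameters ARE in the box (SCREENING-GRADE provenance); `U = 0` band kinematics; no phase
sentence; the E row is a [float] literature refit. Sources: [AndersenEtAl1995, §§5–6]; [PavariniEtAl2001, Eqs. (1)–(3), Fig. 3];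
[HybertsenSchluterChristensen1989, Eq. (1)].
-/

noncomputable section

namespace Summit.Ventures.CertifiedManyBodySolver.Downfold.Emery

open Real Set
open Summit.Ventures.CertifiedManyBodySolver.Downfold

/-! ## §1 Slab windows (raw co-shifted coordinates `t_pp′ := t_pp + a`, `c′ := t_pp′ + a`) -/

/-- **Slab 0, a ∈ [0, 0.1] eV**: on the co-shifted box (t_pp + a ∈ [0.64, 0.95], t_pp′ + a ∈ [0.111, 0.308]) at per-spin
filling ∈ [0.42, 0.4375]: `ε_F ∈ [1.0, 2.38]` and `t′/t ∈ [-0.4138, -0.2482]` — SHORT vs the E row. [folklore] -/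
theorem hg1201AxSlab0_window {Δ tpd tpp c ε : ℝ} (hΔ : Δ ∈ Set.Icc (7 / 5 : ℝ) (5 / 2 : ℝ))
    (ha : tpd ∈ Set.Icc (28 / 25 : ℝ) (33 / 25 : ℝ)) (hb : tpp ∈ Set.Icc (16 / 25 : ℝ) (19 / 20 : ℝ))
    (hc : c ∈ Set.Icc (111 / 1000 : ℝ) (77 / 250 : ℝ))
    (hν : abFilling Δ tpd tpp c ε ∈ Set.Icc (21 / 50 : ℝ) (7 / 16 : ℝ)) :
    ε ∈ Set.Icc (1 : ℝ) (119 / 50 : ℝ) ∧ fsRatio Δ tpd tpp c ε ∈ Set.Icc (-(2069 / 5000 : ℝ)) (-(1241 / 5000 : ℝ)) := by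
  have hΔ' := hΔ
  constructor
  · clear hΔ
    rcases mem_Icc_split hΔ' (39 / 20 : ℝ) with hΔ' | hΔ'
    · rcases mem_Icc_split hΔ' (67 / 40 : ℝ) with hΔ' | hΔ'
      · rcases mem_Icc_split ha (61 / 50 : ℝ) with ha' | ha'
        · have h := (hg1201Ax0Sub_0_0 hΔ' ha' hb hc hν).1
          exact ⟨le_trans (by norm_num) h.1, h.2.trans (by norm_num)⟩
        · have h := (hg1201Ax0Sub_0_1 hΔ' ha' hb hc hν).1
          exact ⟨le_trans (by norm_num) h.1, h.2.trans (by norm_num)⟩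
      · rcases mem_Icc_split ha (61 / 50 : ℝ) with ha' | ha'
        · have h := (hg1201Ax0Sub_1_0 hΔ' ha' hb hc hν).1
          exact ⟨le_trans (by norm_num) h.1, h.2.trans (by norm_num)⟩
        · have h := (hg1201Ax0Sub_1_1 hΔ' ha' hb hc hν).1
          exact ⟨le_trans (by norm_num) h.1, h.2.trans (by norm_num)⟩
    · rcases mem_Icc_split hΔ' (89 / 40 : ℝ) with hΔ' | hΔ'
      · rcases mem_Icc_split ha (61 / 50 : ℝ) with ha' | ha'
        · have h := (hg1201Ax0Sub_2_0 hΔ' ha' hb hc hν).1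
          exact ⟨le_trans (by norm_num) h.1, h.2.trans (by norm_num)⟩
        · have h := (hg1201Ax0Sub_2_1 hΔ' ha' hb hc hν).1
          exact ⟨le_trans (by norm_num) h.1, h.2.trans (by norm_num)⟩
      · rcases mem_Icc_split ha (61 / 50 : ℝ) with ha' | ha'
        · have h := (hg1201Ax0Sub_3_0 hΔ' ha' hb hc hν).1
          exact ⟨le_trans (by norm_num) h.1, h.2.trans (by norm_num)⟩
        · have h := (hg1201Ax0Sub_3_1 hΔ' ha' hb hc hν).1
          exact ⟨le_trans (by norm_num) h.1, h.2.trans (by norm_num)⟩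
  · clear hΔ
    rcases mem_Icc_split hΔ' (39 / 20 : ℝ) with hΔ' | hΔ'
    · rcases mem_Icc_split hΔ' (67 / 40 : ℝ) with hΔ' | hΔ'
      · rcases mem_Icc_split ha (61 / 50 : ℝ) with ha' | ha'
        · have h := (hg1201Ax0Sub_0_0 hΔ' ha' hb hc hν).2
          exact ⟨le_trans (by norm_num) h.1, h.2.trans (by norm_num)⟩
        · have h := (hg1201Ax0Sub_0_1 hΔ' ha' hb hc hν).2
          exact ⟨le_trans (by norm_num) h.1, h.2.trans (by norm_num)⟩
      · rcases mem_Icc_split ha (61 / 50 : ℝ) with ha' | ha'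
        · have h := (hg1201Ax0Sub_1_0 hΔ' ha' hb hc hν).2
          exact ⟨le_trans (by norm_num) h.1, h.2.trans (by norm_num)⟩
        · have h := (hg1201Ax0Sub_1_1 hΔ' ha' hb hc hν).2
          exact ⟨le_trans (by norm_num) h.1, h.2.trans (by norm_num)⟩
    · rcases mem_Icc_split hΔ' (89 / 40 : ℝ) with hΔ' | hΔ'
      · rcases mem_Icc_split ha (61 / 50 : ℝ) with ha' | ha'
        · have h := (hg1201Ax0Sub_2_0 hΔ' ha' hb hc hν).2
          exact ⟨le_trans (by norm_num) h.1, h.2.trans (by norm_num)⟩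
        · have h := (hg1201Ax0Sub_2_1 hΔ' ha' hb hc hν).2
          exact ⟨le_trans (by norm_num) h.1, h.2.trans (by norm_num)⟩
      · rcases mem_Icc_split ha (61 / 50 : ℝ) with ha' | ha'
        · have h := (hg1201Ax0Sub_3_0 hΔ' ha' hb hc hν).2
          exact ⟨le_trans (by norm_num) h.1, h.2.trans (by norm_num)⟩
        · have h := (hg1201Ax0Sub_3_1 hΔ' ha' hb hc hν).2
          exact ⟨le_trans (by norm_num) h.1, h.2.trans (by norm_num)⟩

/-- **Slab 1, a ∈ [0.1, 0.2] eV**: on the co-shifted box (t_pp + a ∈ [0.74, 1.05], t_pp′ + a ∈ [0.211, 0.408]) at per-spin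
filling ∈ [0.42, 0.4375]: `ε_F ∈ [0.96, 2.32]` and `t′/t ∈ [-0.4476, -0.2917]` — SHORT vs the E row. [folklore] -/
theorem hg1201AxSlab1_window {Δ tpd tpp c ε : ℝ} (hΔ : Δ ∈ Set.Icc (7 / 5 : ℝ) (5 / 2 : ℝ))
    (ha : tpd ∈ Set.Icc (28 / 25 : ℝ) (33 / 25 : ℝ)) (hb : tpp ∈ Set.Icc (37 / 50 : ℝ) (21 / 20 : ℝ))
    (hc : c ∈ Set.Icc (211 / 1000 : ℝ) (51 / 125 : ℝ))
    (hν : abFilling Δ tpd tpp c ε ∈ Set.Icc (21 / 50 : ℝ) (7 / 16 : ℝ)) :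
    ε ∈ Set.Icc (24 / 25 : ℝ) (58 / 25 : ℝ) ∧ fsRatio Δ tpd tpp c ε ∈ Set.Icc (-(1119 / 2500 : ℝ)) (-(2917 / 10000 : ℝ)) := by
  have hΔ' := hΔ
  constructor
  · clear hΔ
    rcases mem_Icc_split hΔ' (39 / 20 : ℝ) with hΔ' | hΔ'
    · rcases mem_Icc_split hΔ' (67 / 40 : ℝ) with hΔ' | hΔ'
      · rcases mem_Icc_split ha (61 / 50 : ℝ) with ha' | ha'
        · have h := (hg1201Ax1Sub_0_0 hΔ' ha' hb hc hν).1
          exact ⟨le_trans (by norm_num) h.1, h.2.trans (by norm_num)⟩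
        · have h := (hg1201Ax1Sub_0_1 hΔ' ha' hb hc hν).1
          exact ⟨le_trans (by norm_num) h.1, h.2.trans (by norm_num)⟩
      · rcases mem_Icc_split ha (61 / 50 : ℝ) with ha' | ha'
        · have h := (hg1201Ax1Sub_1_0 hΔ' ha' hb hc hν).1
          exact ⟨le_trans (by norm_num) h.1, h.2.trans (by norm_num)⟩
        · have h := (hg1201Ax1Sub_1_1 hΔ' ha' hb hc hν).1
          exact ⟨le_trans (by norm_num) h.1, h.2.trans (by norm_num)⟩
    · rcases mem_Icc_split hΔ' (89 / 40 : ℝ) with hΔ' | hΔ'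
      · rcases mem_Icc_split ha (61 / 50 : ℝ) with ha' | ha'
        · have h := (hg1201Ax1Sub_2_0 hΔ' ha' hb hc hν).1
          exact ⟨le_trans (by norm_num) h.1, h.2.trans (by norm_num)⟩
        · have h := (hg1201Ax1Sub_2_1 hΔ' ha' hb hc hν).1
          exact ⟨le_trans (by norm_num) h.1, h.2.trans (by norm_num)⟩
      · rcases mem_Icc_split ha (61 / 50 : ℝ) with ha' | ha'
        · have h := (hg1201Ax1Sub_3_0 hΔ' ha' hb hc hν).1
          exact ⟨le_trans (by norm_num) h.1, h.2.trans (by norm_num)⟩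
        · have h := (hg1201Ax1Sub_3_1 hΔ' ha' hb hc hν).1
          exact ⟨le_trans (by norm_num) h.1, h.2.trans (by norm_num)⟩
  · clear hΔ
    rcases mem_Icc_split hΔ' (39 / 20 : ℝ) with hΔ' | hΔ'
    · rcases mem_Icc_split hΔ' (67 / 40 : ℝ) with hΔ' | hΔ'
      · rcases mem_Icc_split ha (61 / 50 : ℝ) with ha' | ha'
        · have h := (hg1201Ax1Sub_0_0 hΔ' ha' hb hc hν).2
          exact ⟨le_trans (by norm_num) h.1, h.2.trans (by norm_num)⟩
        · have h := (hg1201Ax1Sub_0_1 hΔ' ha' hb hc hν).2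
          exact ⟨le_trans (by norm_num) h.1, h.2.trans (by norm_num)⟩
      · rcases mem_Icc_split ha (61 / 50 : ℝ) with ha' | ha'
        · have h := (hg1201Ax1Sub_1_0 hΔ' ha' hb hc hν).2
          exact ⟨le_trans (by norm_num) h.1, h.2.trans (by norm_num)⟩
        · have h := (hg1201Ax1Sub_1_1 hΔ' ha' hb hc hν).2
          exact ⟨le_trans (by norm_num) h.1, h.2.trans (by norm_num)⟩
    · rcases mem_Icc_split hΔ' (89 / 40 : ℝ) with hΔ' | hΔ'
      · rcases mem_Icc_split ha (61 / 50 : ℝ) with ha' | ha'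
        · have h := (hg1201Ax1Sub_2_0 hΔ' ha' hb hc hν).2
          exact ⟨le_trans (by norm_num) h.1, h.2.trans (by norm_num)⟩
        · have h := (hg1201Ax1Sub_2_1 hΔ' ha' hb hc hν).2
          exact ⟨le_trans (by norm_num) h.1, h.2.trans (by norm_num)⟩
      · rcases mem_Icc_split ha (61 / 50 : ℝ) with ha' | ha'
        · have h := (hg1201Ax1Sub_3_0 hΔ' ha' hb hc hν).2
          exact ⟨le_trans (by norm_num) h.1, h.2.trans (by norm_num)⟩
        · have h := (hg1201Ax1Sub_3_1 hΔ' ha' hb hc hν).2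
          exact ⟨le_trans (by norm_num) h.1, h.2.trans (by norm_num)⟩

/-- **Slab 2, a ∈ [0.2, 0.25] eV**: on the co-shifted box (t_pp + a ∈ [0.84, 1.1], t_pp′ + a ∈ [0.311, 0.458]) at per-spin
filling ∈ [0.42, 0.4375]: `ε_F ∈ [0.96, 2.24]` and `t′/t ∈ [-0.4593, -0.3234]` — SHORT vs the E row. [folklore] -/
theorem hg1201AxSlab2_window {Δ tpd tpp c ε : ℝ} (hΔ : Δ ∈ Set.Icc (7 / 5 : ℝ) (5 / 2 : ℝ))
    (ha : tpd ∈ Set.Icc (28 / 25 : ℝ) (33 / 25 : ℝ)) (hb : tpp ∈ Set.Icc (21 / 25 : ℝ) (11 / 10 : ℝ))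
    (hc : c ∈ Set.Icc (311 / 1000 : ℝ) (229 / 500 : ℝ))
    (hν : abFilling Δ tpd tpp c ε ∈ Set.Icc (21 / 50 : ℝ) (7 / 16 : ℝ)) :
    ε ∈ Set.Icc (24 / 25 : ℝ) (56 / 25 : ℝ) ∧ fsRatio Δ tpd tpp c ε ∈ Set.Icc (-(4593 / 10000 : ℝ)) (-(1617 / 5000 : ℝ)) := by
  have hΔ' := hΔ
  constructor
  · clear hΔ
    rcases mem_Icc_split hΔ' (39 / 20 : ℝ) with hΔ' | hΔ'
    · rcases mem_Icc_split hΔ' (67 / 40 : ℝ) with hΔ' | hΔ'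
      · rcases mem_Icc_split ha (61 / 50 : ℝ) with ha' | ha'
        · have h := (hg1201Ax2Sub_0_0 hΔ' ha' hb hc hν).1
          exact ⟨le_trans (by norm_num) h.1, h.2.trans (by norm_num)⟩
        · have h := (hg1201Ax2Sub_0_1 hΔ' ha' hb hc hν).1
          exact ⟨le_trans (by norm_num) h.1, h.2.trans (by norm_num)⟩
      · rcases mem_Icc_split ha (61 / 50 : ℝ) with ha' | ha'
        · have h := (hg1201Ax2Sub_1_0 hΔ' ha' hb hc hν).1
          exact ⟨le_trans (by norm_num) h.1, h.2.trans (by norm_num)⟩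
        · have h := (hg1201Ax2Sub_1_1 hΔ' ha' hb hc hν).1
          exact ⟨le_trans (by norm_num) h.1, h.2.trans (by norm_num)⟩
    · rcases mem_Icc_split hΔ' (89 / 40 : ℝ) with hΔ' | hΔ'
      · rcases mem_Icc_split ha (61 / 50 : ℝ) with ha' | ha'
        · have h := (hg1201Ax2Sub_2_0 hΔ' ha' hb hc hν).1
          exact ⟨le_trans (by norm_num) h.1, h.2.trans (by norm_num)⟩
        · have h := (hg1201Ax2Sub_2_1 hΔ' ha' hb hc hν).1
          exact ⟨le_trans (by norm_num) h.1, h.2.trans (by norm_num)⟩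
      · rcases mem_Icc_split ha (61 / 50 : ℝ) with ha' | ha'
        · have h := (hg1201Ax2Sub_3_0 hΔ' ha' hb hc hν).1
          exact ⟨le_trans (by norm_num) h.1, h.2.trans (by norm_num)⟩
        · have h := (hg1201Ax2Sub_3_1 hΔ' ha' hb hc hν).1
          exact ⟨le_trans (by norm_num) h.1, h.2.trans (by norm_num)⟩
  · clear hΔ
    rcases mem_Icc_split hΔ' (39 / 20 : ℝ) with hΔ' | hΔ'
    · rcases mem_Icc_split hΔ' (67 / 40 : ℝ) with hΔ' | hΔ'
      · rcases mem_Icc_split ha (61 / 50 : ℝ) with ha' | ha'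
        · have h := (hg1201Ax2Sub_0_0 hΔ' ha' hb hc hν).2
          exact ⟨le_trans (by norm_num) h.1, h.2.trans (by norm_num)⟩
        · have h := (hg1201Ax2Sub_0_1 hΔ' ha' hb hc hν).2
          exact ⟨le_trans (by norm_num) h.1, h.2.trans (by norm_num)⟩
      · rcases mem_Icc_split ha (61 / 50 : ℝ) with ha' | ha'
        · have h := (hg1201Ax2Sub_1_0 hΔ' ha' hb hc hν).2
          exact ⟨le_trans (by norm_num) h.1, h.2.trans (by norm_num)⟩
        · have h := (hg1201Ax2Sub_1_1 hΔ' ha' hb hc hν).2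
          exact ⟨le_trans (by norm_num) h.1, h.2.trans (by norm_num)⟩
    · rcases mem_Icc_split hΔ' (89 / 40 : ℝ) with hΔ' | hΔ'
      · rcases mem_Icc_split ha (61 / 50 : ℝ) with ha' | ha'
        · have h := (hg1201Ax2Sub_2_0 hΔ' ha' hb hc hν).2
          exact ⟨le_trans (by norm_num) h.1, h.2.trans (by norm_num)⟩
        · have h := (hg1201Ax2Sub_2_1 hΔ' ha' hb hc hν).2
          exact ⟨le_trans (by norm_num) h.1, h.2.trans (by norm_num)⟩
      · rcases mem_Icc_split ha (61 / 50 : ℝ) with ha' | ha'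
        · have h := (hg1201Ax2Sub_3_0 hΔ' ha' hb hc hν).2
          exact ⟨le_trans (by norm_num) h.1, h.2.trans (by norm_num)⟩
        · have h := (hg1201Ax2Sub_3_1 hΔ' ha' hb hc hν).2
          exact ⟨le_trans (by norm_num) h.1, h.2.trans (by norm_num)⟩

/-- **Slab 3, a ∈ [0.25, 0.3] eV**: on the co-shifted box (t_pp + a ∈ [0.89, 1.15], t_pp′ + a ∈ [0.361, 0.508]) at per-spin
filling ∈ [0.42, 0.4375]: `ε_F ∈ [0.96, 2.22]` and `t′/t ∈ [-0.4714, -0.3372]` — MEETS vs the E row. [folklore] -/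
theorem hg1201AxSlab3_window {Δ tpd tpp c ε : ℝ} (hΔ : Δ ∈ Set.Icc (7 / 5 : ℝ) (5 / 2 : ℝ))
    (ha : tpd ∈ Set.Icc (28 / 25 : ℝ) (33 / 25 : ℝ)) (hb : tpp ∈ Set.Icc (89 / 100 : ℝ) (23 / 20 : ℝ))
    (hc : c ∈ Set.Icc (361 / 1000 : ℝ) (127 / 250 : ℝ))
    (hν : abFilling Δ tpd tpp c ε ∈ Set.Icc (21 / 50 : ℝ) (7 / 16 : ℝ)) :
    ε ∈ Set.Icc (24 / 25 : ℝ) (111 / 50 : ℝ) ∧ fsRatio Δ tpd tpp c ε ∈ Set.Icc (-(2357 / 5000 : ℝ)) (-(843 / 2500 : ℝ)) := by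
  have hΔ' := hΔ
  constructor
  · clear hΔ
    rcases mem_Icc_split hΔ' (39 / 20 : ℝ) with hΔ' | hΔ'
    · rcases mem_Icc_split hΔ' (67 / 40 : ℝ) with hΔ' | hΔ'
      · rcases mem_Icc_split ha (61 / 50 : ℝ) with ha' | ha'
        · have h := (hg1201Ax3Sub_0_0 hΔ' ha' hb hc hν).1
          exact ⟨le_trans (by norm_num) h.1, h.2.trans (by norm_num)⟩
        · have h := (hg1201Ax3Sub_0_1 hΔ' ha' hb hc hν).1
          exact ⟨le_trans (by norm_num) h.1, h.2.trans (by norm_num)⟩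
      · rcases mem_Icc_split ha (61 / 50 : ℝ) with ha' | ha'
        · have h := (hg1201Ax3Sub_1_0 hΔ' ha' hb hc hν).1
          exact ⟨le_trans (by norm_num) h.1, h.2.trans (by norm_num)⟩
        · have h := (hg1201Ax3Sub_1_1 hΔ' ha' hb hc hν).1
          exact ⟨le_trans (by norm_num) h.1, h.2.trans (by norm_num)⟩
    · rcases mem_Icc_split hΔ' (89 / 40 : ℝ) with hΔ' | hΔ'
      · rcases mem_Icc_split ha (61 / 50 : ℝ) with ha' | ha'
        · have h := (hg1201Ax3Sub_2_0 hΔ' ha' hb hc hν).1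
          exact ⟨le_trans (by norm_num) h.1, h.2.trans (by norm_num)⟩
        · have h := (hg1201Ax3Sub_2_1 hΔ' ha' hb hc hν).1
          exact ⟨le_trans (by norm_num) h.1, h.2.trans (by norm_num)⟩
      · rcases mem_Icc_split ha (61 / 50 : ℝ) with ha' | ha'
        · have h := (hg1201Ax3Sub_3_0 hΔ' ha' hb hc hν).1
          exact ⟨le_trans (by norm_num) h.1, h.2.trans (by norm_num)⟩
        · have h := (hg1201Ax3Sub_3_1 hΔ' ha' hb hc hν).1
          exact ⟨le_trans (by norm_num) h.1, h.2.trans (by norm_num)⟩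
  · clear hΔ
    rcases mem_Icc_split hΔ' (39 / 20 : ℝ) with hΔ' | hΔ'
    · rcases mem_Icc_split hΔ' (67 / 40 : ℝ) with hΔ' | hΔ'
      · rcases mem_Icc_split ha (61 / 50 : ℝ) with ha' | ha'
        · have h := (hg1201Ax3Sub_0_0 hΔ' ha' hb hc hν).2
          exact ⟨le_trans (by norm_num) h.1, h.2.trans (by norm_num)⟩
        · have h := (hg1201Ax3Sub_0_1 hΔ' ha' hb hc hν).2
          exact ⟨le_trans (by norm_num) h.1, h.2.trans (by norm_num)⟩
      · rcases mem_Icc_split ha (61 / 50 : ℝ) with ha' | ha'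
        · have h := (hg1201Ax3Sub_1_0 hΔ' ha' hb hc hν).2
          exact ⟨le_trans (by norm_num) h.1, h.2.trans (by norm_num)⟩
        · have h := (hg1201Ax3Sub_1_1 hΔ' ha' hb hc hν).2
          exact ⟨le_trans (by norm_num) h.1, h.2.trans (by norm_num)⟩
    · rcases mem_Icc_split hΔ' (89 / 40 : ℝ) with hΔ' | hΔ'
      · rcases mem_Icc_split ha (61 / 50 : ℝ) with ha' | ha'
        · have h := (hg1201Ax3Sub_2_0 hΔ' ha' hb hc hν).2
          exact ⟨le_trans (by norm_num) h.1, h.2.trans (by norm_num)⟩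
        · have h := (hg1201Ax3Sub_2_1 hΔ' ha' hb hc hν).2
          exact ⟨le_trans (by norm_num) h.1, h.2.trans (by norm_num)⟩
      · rcases mem_Icc_split ha (61 / 50 : ℝ) with ha' | ha'
        · have h := (hg1201Ax3Sub_3_0 hΔ' ha' hb hc hν).2
          exact ⟨le_trans (by norm_num) h.1, h.2.trans (by norm_num)⟩
        · have h := (hg1201Ax3Sub_3_1 hΔ' ha' hb hc hν).2
          exact ⟨le_trans (by norm_num) h.1, h.2.trans (by norm_num)⟩

end Summit.Ventures.CertifiedManyBodySolver.Downfold.Emery
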